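import Literature.NumberTheory.EllipticCurves.BSDInvariants
import Literature.NumberTheory.EllipticCurves.TamagawaVariableChangeProofs
import HarnessLib

/-!
# Discharge of the named fact `tamagawaProduct_variableChange` of `BSDInvariants.lean`

Sibling file of `Literature.NumberTheory.EllipticCurves.BSDInvariants` (D-0014: named facts are
`def X : Prop`, a discharge is `theorem X_holds : X`). The content — the Tamagawa product
`∏ᶠ v, c_v` of an *elliptic* curve over a number field does not depend on the Weierstrass
equation — is proved in `TamagawaVariableChangeProofs` as
`WeierstrassCurve.tamagawaProduct_variableChange_eq` (place by place from
`localTamagawaNumber_variableChange_holds`: the local factor is computed on a local minimal model,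
unique up to `u ∈ Rˣ`, `r, s, t ∈ R` for `Δ ≠ 0`, Silverman, *AEC*, VII.1.3(b), and `E₀(K_v)` does
not depend on that choice, VII.2). That file is deliberately kept below `BSDInvariants` in the
import graph, so the one-line wrapper discharging the fact *as named in* `BSDInvariants.lean`
lives here.

## References

* J. H. Silverman, *The Arithmetic of Elliptic Curves*, 2nd ed., GTM 106 (2009), VII.1.3(b),
  VII.2, VII.6, Conj. C.16.5.
-/

noncomputable section

open scoped Classical

universe u

namespace WeierstrassCurve

variable {K : Type u} [Field K] [NumberField K] (W : WeierstrassCurve K) (C : VariableChange K)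

/-- **Silverman, *AEC* VII.2 with VII.1.3(b), VII.6**: the Tamagawa product of an elliptic curve
over a number field is invariant under admissible changes of variables. Discharge of the named
fact `tamagawaProduct_variableChange` (`∀ [W.IsElliptic], (C • W).tamagawaProduct =
W.tamagawaProduct`) by `tamagawaProduct_variableChange_eq` (`TamagawaVariableChangeProofs`).
[cite: SilvermanAEC2009, VII.2 with VII.1 Prop. 1.3(b); VII.6] -/
theorem tamagawaProduct_variableChange_holds : tamagawaProduct_variableChange W C :=
  fun {_} => tamagawaProduct_variableChange_eq W C

end WeierstrassCurve

end
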